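import Summits.BirchSwinnertonDyer.Rank1Residual.Additive.X3BranchLambda
import Summits.BirchSwinnertonDyer.Rank1Residual.Additive.QuadraticBranchLowerDescentSemistable
import Summits.BirchSwinnertonDyer.Rank1Residual.Additive.ChiBranchLowerEndStatePotMult
import Summits.BirchSwinnertonDyer.Rank1Residual.Additive.ChiBranchLowerTransportGord
import HarnessLib

/-!
# X3 on the semistable-twist locus, LOWER half END TO END: the `ω^{(p−1)/2}`-branch main conjecture
# of `E♭` (row T-c2x3) BRIDGED to row T-c2's lower containment, DESCENDED to the additive curve `E`,
# composed into `BSDp E p` on X3♯(M) ∧ `r_an = 0` / `Typed.MissingLowerBoundAt E p` on X3♯(G-ord,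
# `e = 2`) ∧ `r_an = 0` (cell `b2b-bsdres`, team n1011, seat p12 (gen 2), OWNERS row T-c2x3 (v))

HONEST FRAMING (cell `b2b-bsdres`, run/shared/lean/b2b/bsd-rank1-residual/, verbatim in every
file): the goal of the cell is to DELETE the COMBINATION-SHAPED residual classes of the
Birch–Swinnerton-Dyer formula for ALL analytic-rank `≤ 1` elliptic curves over `ℚ` — "full BSD
formula for every rank `≤ 1` curve in class `C`" assembled STRICTLY from published theorems — so
that the rank-`≤ 1` remainder becomes exactly the CONSTRUCTION-SHAPED classes, which are TYPED
(missing-input `Prop`s), NOT attempted. This is not "finishing BSD". Team n1011 (RESIDUAL-MAP §I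
N10, X3 = additive `p`, `E[p]` REDUCIBLE), seat `b2b-bsdres-n1011-p12` (gen 2), row T-c2x3 (v):
research route on the CONSTRUCTION-SHAPED class X3; labels and marks UNCHANGED; nothing booked; NO
Literature fact minted. THEOREMS ONLY: compositions of the team's typed conjectures (`@[conjecture]
def`s under `Summits/`, NOT in print, nothing asserted — explicit hypotheses) with the cell's kernel
descent and PUBLISHED named facts of the tree, each an explicit binder (`hW16` Wuthrich 2014
Thm. 16; `hDel`/`hDelX` Delbourgo 1998 Prop. 4; `hPal` Pal 2012 Thm. 3.2, `d > 0`; `hGZK`;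
`hmod`/`hmodD`; `hEx` the typed exact leading term on (G-ord)).

## What and why

Row T-c2x3 (seat p12 gen 1) TYPED the missing half on the X3 side of the semistable-twist locus as
the `ω^{(p−1)/2}`-BRANCH MAIN CONJECTURE of the twist `V = E♭` (`X3Branch.X3BranchMainConjectureAt V p`,
in the vocabulary of the tree's PUBLISHED half `Wuthrich2014.thm16_halfEigenCharIdeal_dvd_cyclotomicPrime`,
Literature `EigenSelmerDualData`), showed it is "Greenberg–Vatsal ON THE BRANCH" (`λ`-equality ∧
analytic `μ = 0` bit, granted Wuthrich's half), and stopped at the `Λ`-level. Row T-c2 (seat p10)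
typed the SAME direction on the same component in the cell's descent vocabulary
(`QuadraticBranchLowerDivisibilityAt V p`, additive-p2's `ChiEigenSelmerInDualData`) and descended it
to row T-N10-low's `T = 0` inputs `ChiBranchLowerLeadingTerm[Odd]At W p` (seat p07), which compose
into the Miller-currency LOWER half and, on X3♯(M), into `BSDp`. THIS FILE joins the three:

* §1 **Λ-level bridge on `E♭`** (anti-drift between the two typed LOWER conjectures): for `V[p]`
  REDUCIBLE, p12's branch main conjecture ⟹ p10's lower containment
  (`X3Branch.quadraticBranchLowerDivisibilityAt_of_mainConjecture`; additive-p1's `rfl`-conversion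
  `ChiEigenSelmerInDualData.toEigen`), and conversely GIVEN Wuthrich's published half `hW16`
  (`X3Branch.mainConjectureAt_of_quadraticBranchLower_of_thm16`: `ι` injective, the two
  divisibilities differ by a unit of `ℤ_p`); `X3Branch.mainConjectureAt_iff_quadraticBranchLower_of_thm16`
  — on the X3 side the two typings are ONE conjecture granted print.
* §2 **Descent to the additive curve (X3 forms).** With `E[p]` reducible every twist model `V` has
  `V[p]` reducible (additive-p1's `irr_iff_of_model_twist`), so §1 feeds seat p10's `T = 0` descent
  on the WHOLE semistable-twist locus (`chiBranchLowerLeadingTerm[Odd]At_of_quadraticBranchLower`,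
  good ordinary OR multiplicative twist, both parities):
  `X3Branch.chiBranchLowerLeadingTerm[Odd]At_of_forall_mainConjecture`; and GV on the branch ∧ the
  `μ`-bit ∧ `hW16` give the branch main conjecture for every twist model
  (`X3Branch.forall_mainConjecture_of_forall_lambdaEq_of_muZero`, over gen 1's
  `x3BranchMainConjectureAt_of_lambdaEq_of_muZero`).
* §3 **END TO END** (the row's named consumer "X3BranchLambdaEq ∧ μ-bits ∧ Wuthrich Thm 16 ⟹ the
  LOWER half on X3 ∩ SubSemistableTwist ∧ r0"), binders passed VERBATIM to seat p07's consumers: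
  on X3♯(M) ∧ `r_an = 0` the FULL `p`-part `BSDp W p` (`ClassX3M.bsdp_rankZero_of_chiBranchLower[Odd]`,
  `ChiBranchLowerEndStatePotMult.lean`, whose UPPER half is additive-p1's Wuthrich Thm. 16 chain):
  `ClassX3M.bsdp_rankZero_of_x3BranchMainConjecture[_odd]`,
  `ClassX3M.bsdp_rankZero_of_x3BranchLambdaEq_of_muZero[_odd]`; on X3♯(G-ord) ∩ `I₀*` ∧ `r_an = 0`,
  given the typed exact leading term `ExactLeadingTermAt W p` (row T-N10b),
  `Typed.MissingLowerBoundAt W p` (`ClassX3Gord.missingLowerBoundAt_rankZero_of_chiBranchLower[Odd]_of_exact`):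
  `ClassX3Gord.missingLowerBoundAt_rankZero_of_x3BranchMainConjecture[_odd]_of_exact`,
  `ClassX3Gord.missingLowerBoundAt_rankZero_of_x3BranchLambdaEq_of_muZero[_odd]_of_exact`.

Nothing here is a class theorem: X3 stays CONSTRUCTION-SHAPED. Kernel sentence: on X3♯(M) ∧
`r_an = 0`, granted print, `BSD(E,p)` ⟸ Greenberg–Vatsal's `λ`-computation on the branch `(p−1)/2`
of `E♭` (TYPED, OPEN) + one analytic `μ`-certificate per pair (instrument I-10; ROUTE-2 II.6:
method-shaped on `crit(E)`, conjecture-shaped off it); on X3♯(G-ord, `e = 2`) plus the exact term.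

References: [GreenbergVatsal2000] Thm. (1.3), p. 4; [Wuthrich2014] Thm. 16; [SkinnerUrban2014]
Thm. 3.6.4 (shape only); [MazurTateTeitelbaum1986Invent] §I.13–I.14; [GreenbergLNM1716] §5;
[Delbourgo1998] Thm. 3 / Prop. 4; [Pal2012] Thm. 3.2.
-/

noncomputable section

open scoped Classical MatrixGroups ModularForm

namespace Summit.BirchSwinnertonDyer.Rank1Residual.Additive

open CongruenceSubgroup WeierstrassCurve Literature.NumberTheory.EllipticCurves
  Literature.NumberTheory.EllipticCurves.ModularForms
  Literature.NumberTheory.EllipticCurves.Rank1Residual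
  Literature.NumberTheory.EllipticCurves.Rank1Residual.Typed
  Literature.NumberTheory.GaloisRepresentations
  Summit.BirchSwinnertonDyer.Rank1Residual.AdditivePotMult
  Summit.BirchSwinnertonDyer.Rank1Residual.Additive.X3Branch

/-! ### §1 The Λ-level bridge on `E♭`: branch main conjecture (p12) ↔ lower containment (p10) -/

section Bridge

variable {V : WeierstrassCurve ℚ} [V.IsElliptic] [V.IsGloballyMinimal] {p : ℕ} [hp : Fact p.Prime]

/-- **Row T-c2x3's branch main conjecture IMPLIES row T-c2's lower containment, for `V[p]`
reducible**: if `char_Λ X_m = (g')`, `ι g' = C(u·ϖ)·B` for every half-eigen datum, then every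
`g ∈ char_Λ D.X` of every cell eigen datum `D` (which IS a Literature eigen datum with the same
module: additive-p1's `ChiEigenSelmerInDualData.toEigen`, `rfl`) is `h·(ϖ·B)` in `ℚ_p⟦T⟧`,
`h = u·(g/g') ∈ Λ`. Bookkeeping between two typings of ONE conjecture; nothing asserted.
[cite: Wuthrich2014, Thm. 16 (p. 397) (binder shape)] [cite: SkinnerUrban2014, Thm. 3.6.4 (p. 43) (shape only; nothing asserted)] -/
theorem X3Branch.quadraticBranchLowerDivisibilityAt_of_mainConjecture
    (hirr : ¬ V.HasIrreducibleModPGaloisRep p) (hMC : X3BranchMainConjectureAt V p) :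
    QuadraticBranchLowerDivisibilityAt V p := by
  intro K _ _ _ F _ _ _ _ κ γ N _ f B hp2 hK2 hθ hB hκ hγ hcv hγK hγF hf D ϖ hϖ g hg
  obtain ⟨-, g', hchar, u, hι⟩ := hMC K F B hp2 hK2 hθ hB hirr hκ hγ hcv hγK hγF hf
    (ChiEigenSelmerInDualData.toEigen V K κ (galRange (K := ℚ) F) γ D) ϖ hϖ
  -- `g ∈ char_Λ D.X = char (toEigen D) = (g')`
  have hg' : g ∈ Ideal.span ({g'} : Set (IwasawaAlgebra p)) := by
    rw [← hchar]; exact hg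
  obtain ⟨a, rfl⟩ := Ideal.mem_span_singleton'.mp hg'
  refine ⟨PowerSeries.C (u : ℤ_[p]) * a, ?_⟩
  have hC : PowerSeries.C ((((u : ℤ_[p]) : ℚ_[p])) * (ϖ : ℚ_[p])) =
      PowerSeries.C (((u : ℤ_[p]) : ℚ_[p])) * PowerSeries.C (ϖ : ℚ_[p]) := map_mul _ _ _
  rw [map_mul, hι, iwasawaToPowerSeries_C_mul', hC]
  ring

/-- **Conversely: row T-c2's lower containment ∧ Wuthrich's PUBLISHED half ⟹ row T-c2x3's branch
main conjecture** (`V[p]` reducible; Wuthrich 2014 Thm. 16 on the component `(p−1)/2` = `hW16`):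
Wuthrich gives `g' ∈ char X_m`, `ι g' = C(uϖ)·B`; the containment gives `ι g = ι h·(ϖ B) =
ι(C u⁻¹·h·g')` for every `g ∈ char X_m`, so `g ∈ (g')` (`ι` injective) and `char X_m = (g')` (a
Literature eigen datum read field for field as a cell datum). [cite: Wuthrich2014, Thm. 16 (p. 397)]
[cite: GreenbergVatsal2000, (1.1) and p. 4] -/
theorem X3Branch.mainConjectureAt_of_quadraticBranchLower_of_thm16
    (hW16 : Wuthrich2014.thm16_halfEigenCharIdeal_dvd_cyclotomicPrime)
    (hc : QuadraticBranchLowerDivisibilityAt V p) : X3BranchMainConjectureAt V p := by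
  intro K _ _ _ F _ _ _ _ κ γ N _ f B hp2 hK2 hθ hB hirr hκ hγ hcv hγK hγF hf D ϖ hϖ
  obtain ⟨htors, g', hg'mem, u, hι⟩ :=
    hW16 p V K F B hp2 hK2 hθ hB hirr hκ hγ hcv hγK hγF hf D ϖ hϖ
  refine ⟨htors, g', le_antisymm (fun g hg ↦ ?_)
    ((Ideal.span_singleton_le_iff_mem _).mpr hg'mem), u, hι⟩
  -- the cell eigen datum with the SAME module
  let D' : ChiEigenSelmerInDualData V K κ (galRange (K := ℚ) F) γ :=
    { X := D.X, toDual := D.toDual, bijective := D.bijective,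
      toDual_T_smul := D.toDual_T_smul, toDual_C_smul := D.toDual_C_smul }
  have hgX : g ∈ Literature.NumberTheory.EllipticCurves.Module.charIdeal (IwasawaAlgebra p) D'.X :=
    hg
  obtain ⟨h, hιg⟩ := hc K F B hp2 hK2 hθ hB hκ hγ hcv hγK hγF hf D' ϖ hϖ g hgX
  -- `ι g = ι h · ϖ B = ι (C u⁻¹ · h) · ι g'`
  have hu0 : (((u : ℤ_[p]) : ℚ_[p])) ≠ 0 := by
    rw [Ne, PadicInt.coe_eq_zero]
    exact u.ne_zero
  have hCC : PowerSeries.C ((((u : ℤ_[p]) : ℚ_[p]))⁻¹) *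
      PowerSeries.C ((((u : ℤ_[p]) : ℚ_[p])) * (ϖ : ℚ_[p])) = PowerSeries.C (ϖ : ℚ_[p]) := by
    rw [← map_mul, ← mul_assoc, inv_mul_cancel₀ hu0, one_mul]
  refine Ideal.mem_span_singleton'.mpr ⟨PowerSeries.C ((u⁻¹ : ℤ_[p]ˣ) : ℤ_[p]) * h, ?_⟩
  apply iwasawaToPowerSeries_injective p
  rw [map_mul, iwasawaToPowerSeries_C_mul', hι, hιg, coe_units_inv_eq_inv]
  calc PowerSeries.C ((((u : ℤ_[p]) : ℚ_[p]))⁻¹) * iwasawaToPowerSeries p h *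
        (PowerSeries.C ((((u : ℤ_[p]) : ℚ_[p])) * (ϖ : ℚ_[p])) * B)
      = iwasawaToPowerSeries p h * ((PowerSeries.C ((((u : ℤ_[p]) : ℚ_[p]))⁻¹) *
          PowerSeries.C ((((u : ℤ_[p]) : ℚ_[p])) * (ϖ : ℚ_[p]))) * B) := by ring
    _ = iwasawaToPowerSeries p h * (PowerSeries.C (ϖ : ℚ_[p]) * B) := by rw [hCC]

/-- **On the X3 side the two typed LOWER conjectures are ONE, granted print** (`V[p]` reducible,
Wuthrich's half `hW16`). [cite: Wuthrich2014, Thm. 16 (p. 397)] [cite: GreenbergVatsal2000, p. 4] -/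
theorem X3Branch.mainConjectureAt_iff_quadraticBranchLower_of_thm16
    (hW16 : Wuthrich2014.thm16_halfEigenCharIdeal_dvd_cyclotomicPrime)
    (hirr : ¬ V.HasIrreducibleModPGaloisRep p) :
    X3BranchMainConjectureAt V p ↔ QuadraticBranchLowerDivisibilityAt V p :=
  ⟨X3Branch.quadraticBranchLowerDivisibilityAt_of_mainConjecture hirr,
    X3Branch.mainConjectureAt_of_quadraticBranchLower_of_thm16 hW16⟩

end Bridge

/-! ### §2 Descent to the additive curve: the X3 forms of seat p10's `T = 0` descent -/

section Descent

variable (W : WeierstrassCurve ℚ) [W.IsElliptic] (p : ℕ) [hp : Fact p.Prime]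

/-- **The X3 form of the hypothesis**: if `W[p]` is reducible, `X3BranchMainConjectureAt V p` for
every twist model `V` of `W` gives `QuadraticBranchLowerDivisibilityAt V p` for every twist model
(`V[p]` reducible with `W[p]`: additive-p1's `irr_iff_of_model_twist`; then §1). [folklore] -/
theorem X3Branch.forall_quadraticBranchLower_of_forall_mainConjecture
    (hredW : ¬ W.HasIrreducibleModPGaloisRep p)
    (hMC : ∀ (V : WeierstrassCurve ℚ) [V.IsElliptic] [V.IsGloballyMinimal],
      (∃ C : VariableChange ℚ, C • V.quadraticTwist ((-1) ^ (p / 2) * p : ℚ) = W) →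
        X3BranchMainConjectureAt V p) :
    ∀ (V : WeierstrassCurve ℚ) [V.IsElliptic] [V.IsGloballyMinimal],
      (∃ C : VariableChange ℚ, C • V.quadraticTwist ((-1) ^ (p / 2) * p : ℚ) = W) →
        QuadraticBranchLowerDivisibilityAt V p := by
  intro V _ _ hVW
  have hd : ((-1 : ℚ) ^ (p / 2) * p) ≠ 0 :=
    mul_ne_zero (pow_ne_zero _ (by norm_num)) (Nat.cast_ne_zero.mpr hp.out.ne_zero)
  exact X3Branch.quadraticBranchLowerDivisibilityAt_of_mainConjecture
    (fun hV ↦ hredW ((irr_iff_of_model_twist (W := V) (p := p) hd hVW).mpr hV)) (hMC V hVW)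

/-- **X3, `T = 0`, even branch (`p ≡ 1 (mod 4)`)**: `W[p]` reducible ∧ (`∀` twist models, the
branch main conjecture) ⟹ `ChiBranchLowerLeadingTermAt W p` — seat p10's descent on the whole
semistable-twist locus (`chiBranchLowerLeadingTermAt_of_quadraticBranchLower`) applied to §1.
[cite: MazurTateTeitelbaum1986Invent, §I.13–I.14] [cite: GreenbergLNM1716, §5 (PDF p. 143)] -/
theorem X3Branch.chiBranchLowerLeadingTermAt_of_forall_mainConjecture
    (hredW : ¬ W.HasIrreducibleModPGaloisRep p)
    (hMC : ∀ (V : WeierstrassCurve ℚ) [V.IsElliptic] [V.IsGloballyMinimal],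
      (∃ C : VariableChange ℚ, C • V.quadraticTwist ((-1) ^ (p / 2) * p : ℚ) = W) →
        X3BranchMainConjectureAt V p) :
    ChiBranchLowerLeadingTermAt W p :=
  chiBranchLowerLeadingTermAt_of_quadraticBranchLower W p
    (X3Branch.forall_quadraticBranchLower_of_forall_mainConjecture W p hredW hMC)

/-- **X3, `T = 0`, odd branch (`p ≡ 3 (mod 4)`, `p = 3` included)**: `W[p]` reducible ∧ (`∀` twist
models, the branch main conjecture) ⟹ `ChiBranchLowerLeadingTermOddAt W p` (seat p10's
`chiBranchLowerLeadingTermOddAt_of_quadraticBranchLower` applied to §1).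
[cite: MazurTateTeitelbaum1986Invent, §I.13–I.14] [cite: GreenbergLNM1716, §5 (PDF p. 143)] -/
theorem X3Branch.chiBranchLowerLeadingTermOddAt_of_forall_mainConjecture
    (hredW : ¬ W.HasIrreducibleModPGaloisRep p)
    (hMC : ∀ (V : WeierstrassCurve ℚ) [V.IsElliptic] [V.IsGloballyMinimal],
      (∃ C : VariableChange ℚ, C • V.quadraticTwist ((-1) ^ (p / 2) * p : ℚ) = W) →
        X3BranchMainConjectureAt V p) :
    ChiBranchLowerLeadingTermOddAt W p :=
  chiBranchLowerLeadingTermOddAt_of_quadraticBranchLower W p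
    (X3Branch.forall_quadraticBranchLower_of_forall_mainConjecture W p hredW hMC)

omit [W.IsElliptic] in
/-- **GV on the branch for every twist model ⟹ the branch main conjecture for every twist model**,
granted Wuthrich's half `hW16` and the analytic `μ = 0` certificates (gen 1's theorem, quantified
over the twist models). [cite: GreenbergVatsal2000, p. 4] [cite: Wuthrich2014, Thm. 16 (p. 397)] -/
theorem X3Branch.forall_mainConjecture_of_forall_lambdaEq_of_muZero
    (hW16 : Wuthrich2014.thm16_halfEigenCharIdeal_dvd_cyclotomicPrime)
    (hlam : ∀ (V : WeierstrassCurve ℚ) [V.IsElliptic] [V.IsGloballyMinimal],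
      (∃ C : VariableChange ℚ, C • V.quadraticTwist ((-1) ^ (p / 2) * p : ℚ) = W) →
        X3BranchLambdaEqAt V p)
    (hμ : ∀ (V : WeierstrassCurve ℚ) [V.IsElliptic] [V.IsGloballyMinimal],
      (∃ C : VariableChange ℚ, C • V.quadraticTwist ((-1) ^ (p / 2) * p : ℚ) = W) →
        X3BranchAnalyticMuZeroAt V p) :
    ∀ (V : WeierstrassCurve ℚ) [V.IsElliptic] [V.IsGloballyMinimal],
      (∃ C : VariableChange ℚ, C • V.quadraticTwist ((-1) ^ (p / 2) * p : ℚ) = W) →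
        X3BranchMainConjectureAt V p :=
  fun V _ _ hVW ↦ x3BranchMainConjectureAt_of_lambdaEq_of_muZero hW16 (hlam V hVW) (hμ V hVW)

end Descent

/-! ### §3 END TO END: `BSDp` on X3♯(M) ∧ `r_an = 0`; the LOWER half on X3♯(G-ord, `e = 2`) ∧ `r_an = 0` -/

section EndToEnd

variable {W : WeierstrassCurve ℚ} [W.IsElliptic] [W.IsGloballyMinimal] {p : ℕ} [hp : Fact p.Prime]

/-- **X3♯(M) ∧ `r_an = 0`, `p ≡ 1 (mod 4)`: the `ω^{(p−1)/2}`-branch main conjecture of EVERY twist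
model `E♭` ⟹ `BSDp E p`** — §2 into seat p07's `ClassX3M.bsdp_rankZero_of_chiBranchLower` (UPPER
half = Wuthrich Thm. 16 chain `hW16`; LOWER via Birch + Pal `hPal`, Delbourgo 1998 Prop. 4 (M)
exact `hDel`/`hDelX`, GZK, modularity). NOT a class theorem (typed conjecture `hMC`).
[cite: Delbourgo1998, Prop. 4 (p. 144)] [cite: Wuthrich2014, Thm. 16 (p. 397)] [cite: Pal2012, Thm. 3.2] -/
theorem ClassX3M.bsdp_rankZero_of_x3BranchMainConjecture
    (hDel : Delbourgo1998.prop4_rankZero_pow_dvd_constantCoeff)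
    (hDelX : Delbourgo1998.prop4_rankZero_constantCoeff_eq_unit_mul_of_potMult)
    (hPal : Pal2012.thm32_sqrt_mul_realPeriodRat_twist_eq_of_prime_one_mod_four)
    (hGZK : rank_eq_analyticRank_of_analyticRank_le_one) (hmod : hasEntireLFunction_rat)
    (hmodD : nonempty_modularParametrizationData)
    (hW16 : Wuthrich2014.thm16_halfEigenCharIdeal_dvd_cyclotomicPrime)
    (hX : ClassX3M W p) (hp4 : p % 4 = 1) (hr : W.analyticRank = 0)
    (hMC : ∀ (V : WeierstrassCurve ℚ) [V.IsElliptic] [V.IsGloballyMinimal],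
      (∃ C : VariableChange ℚ, C • V.quadraticTwist ((-1) ^ (p / 2) * p : ℚ) = W) →
        X3BranchMainConjectureAt V p) :
    BSDp W p :=
  ClassX3M.bsdp_rankZero_of_chiBranchLower hDel hDelX hPal hGZK hmod hmodD hW16 hX hp4 hr
    (X3Branch.chiBranchLowerLeadingTermAt_of_forall_mainConjecture W p hX.classX3.1 hMC)

/-- **X3♯(M) ∧ `r_an = 0`, `p ≡ 3 (mod 4)` (`p = 3` included): the branch main conjecture of every
twist model `E♭` ⟹ `BSDp E p`** (Pal for `d < 0` is a tree theorem: no `hPal`).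
[cite: Delbourgo1998, Prop. 4 (p. 144) and §2.2 Lemma (ii) (p. 139)]
[cite: Wuthrich2014, Thm. 16 (p. 397)] [cite: Pal2012, Thm. 3.2] -/
theorem ClassX3M.bsdp_rankZero_of_x3BranchMainConjecture_odd
    (hDel : Delbourgo1998.prop4_rankZero_pow_dvd_constantCoeff)
    (hDelX : Delbourgo1998.prop4_rankZero_constantCoeff_eq_unit_mul_of_potMult)
    (hGZK : rank_eq_analyticRank_of_analyticRank_le_one) (hmod : hasEntireLFunction_rat)
    (hmodD : nonempty_modularParametrizationData)
    (hW16 : Wuthrich2014.thm16_halfEigenCharIdeal_dvd_cyclotomicPrime)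
    (hX : ClassX3M W p) (hp4 : p % 4 = 3) (hr : W.analyticRank = 0)
    (hMC : ∀ (V : WeierstrassCurve ℚ) [V.IsElliptic] [V.IsGloballyMinimal],
      (∃ C : VariableChange ℚ, C • V.quadraticTwist ((-1) ^ (p / 2) * p : ℚ) = W) →
        X3BranchMainConjectureAt V p) :
    BSDp W p :=
  ClassX3M.bsdp_rankZero_of_chiBranchLowerOdd hDel hDelX hGZK hmod hmodD hW16 hX hp4 hr
    (X3Branch.chiBranchLowerLeadingTermOddAt_of_forall_mainConjecture W p hX.classX3.1 hMC)

/-- **THE ROW'S CONSUMER on X3♯(M) ∧ `r_an = 0`, `p ≡ 1 (mod 4)`**: Wuthrich 2014 Thm. 16 (`hW16`) ∧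
Greenberg–Vatsal ON THE BRANCH for every twist model (`X3BranchLambdaEqAt`, TYPED, OPEN) ∧ the
analytic `μ = 0` certificate for every twist model (`X3BranchAnalyticMuZeroAt`, per-pair census
bit) ⟹ `BSDp E p`, the other inputs PUBLISHED (`hDel hDelX hPal hGZK hmod hmodD`).
[cite: GreenbergVatsal2000, Thm. (1.3) and p. 4] [cite: Wuthrich2014, Thm. 16 (p. 397)]
[cite: Delbourgo1998, Prop. 4 (p. 144)] [cite: Pal2012, Thm. 3.2] -/
theorem ClassX3M.bsdp_rankZero_of_x3BranchLambdaEq_of_muZero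
    (hDel : Delbourgo1998.prop4_rankZero_pow_dvd_constantCoeff)
    (hDelX : Delbourgo1998.prop4_rankZero_constantCoeff_eq_unit_mul_of_potMult)
    (hPal : Pal2012.thm32_sqrt_mul_realPeriodRat_twist_eq_of_prime_one_mod_four)
    (hGZK : rank_eq_analyticRank_of_analyticRank_le_one) (hmod : hasEntireLFunction_rat)
    (hmodD : nonempty_modularParametrizationData)
    (hW16 : Wuthrich2014.thm16_halfEigenCharIdeal_dvd_cyclotomicPrime)
    (hX : ClassX3M W p) (hp4 : p % 4 = 1) (hr : W.analyticRank = 0)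
    (hlam : ∀ (V : WeierstrassCurve ℚ) [V.IsElliptic] [V.IsGloballyMinimal],
      (∃ C : VariableChange ℚ, C • V.quadraticTwist ((-1) ^ (p / 2) * p : ℚ) = W) →
        X3BranchLambdaEqAt V p)
    (hμ : ∀ (V : WeierstrassCurve ℚ) [V.IsElliptic] [V.IsGloballyMinimal],
      (∃ C : VariableChange ℚ, C • V.quadraticTwist ((-1) ^ (p / 2) * p : ℚ) = W) →
        X3BranchAnalyticMuZeroAt V p) :
    BSDp W p :=
  ClassX3M.bsdp_rankZero_of_x3BranchMainConjecture hDel hDelX hPal hGZK hmod hmodD hW16 hX hp4 hr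
    (X3Branch.forall_mainConjecture_of_forall_lambdaEq_of_muZero W p hW16 hlam hμ)

/-- **THE ROW'S CONSUMER on X3♯(M) ∧ `r_an = 0`, `p ≡ 3 (mod 4)` (`p = 3` included)**: `hW16` ∧ GV on
the branch ∧ the `μ`-certificate, for every twist model ⟹ `BSDp E p`. [cite: Wuthrich2014, Thm. 16]
[cite: GreenbergVatsal2000, Thm. (1.3) and p. 4] [cite: Delbourgo1998, Prop. 4 (p. 144)] -/
theorem ClassX3M.bsdp_rankZero_of_x3BranchLambdaEq_of_muZero_odd
    (hDel : Delbourgo1998.prop4_rankZero_pow_dvd_constantCoeff)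
    (hDelX : Delbourgo1998.prop4_rankZero_constantCoeff_eq_unit_mul_of_potMult)
    (hGZK : rank_eq_analyticRank_of_analyticRank_le_one) (hmod : hasEntireLFunction_rat)
    (hmodD : nonempty_modularParametrizationData)
    (hW16 : Wuthrich2014.thm16_halfEigenCharIdeal_dvd_cyclotomicPrime)
    (hX : ClassX3M W p) (hp4 : p % 4 = 3) (hr : W.analyticRank = 0)
    (hlam : ∀ (V : WeierstrassCurve ℚ) [V.IsElliptic] [V.IsGloballyMinimal],
      (∃ C : VariableChange ℚ, C • V.quadraticTwist ((-1) ^ (p / 2) * p : ℚ) = W) →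
        X3BranchLambdaEqAt V p)
    (hμ : ∀ (V : WeierstrassCurve ℚ) [V.IsElliptic] [V.IsGloballyMinimal],
      (∃ C : VariableChange ℚ, C • V.quadraticTwist ((-1) ^ (p / 2) * p : ℚ) = W) →
        X3BranchAnalyticMuZeroAt V p) :
    BSDp W p :=
  ClassX3M.bsdp_rankZero_of_x3BranchMainConjecture_odd hDel hDelX hGZK hmod hmodD hW16 hX hp4 hr
    (X3Branch.forall_mainConjecture_of_forall_lambdaEq_of_muZero W p hW16 hlam hμ)

/-- **X3♯(G-ord) ∩ `I₀*` (`e = 2`) ∧ `r_an = 0`, `p ≡ 1 (mod 4)`: the branch main conjecture of every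
twist model ∧ the typed exact leading term `ExactLeadingTermAt W p` (row T-N10b) ⟹
`Typed.MissingLowerBoundAt W p`** — §2 into seat p07's `ClassX3Gord.…_of_chiBranchLower_of_exact`.
[cite: Pal2012, Thm. 3.2] [cite: Delbourgo1998, Prop. 4 (p. 144) (shape of the exact input)] -/
theorem ClassX3Gord.missingLowerBoundAt_rankZero_of_x3BranchMainConjecture_of_exact
    (hPal : Pal2012.thm32_sqrt_mul_realPeriodRat_twist_eq_of_prime_one_mod_four)
    (hGZK : rank_eq_analyticRank_of_analyticRank_le_one) (hmod : hasEntireLFunction_rat)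
    (hmodD : nonempty_modularParametrizationData)
    (hX : ClassX3Gord W p) (he : semistabilityIndex W p = 2) (hp4 : p % 4 = 1)
    (hr : W.analyticRank = 0) (hEx : ExactLeadingTermAt W p)
    (hMC : ∀ (V : WeierstrassCurve ℚ) [V.IsElliptic] [V.IsGloballyMinimal],
      (∃ C : VariableChange ℚ, C • V.quadraticTwist ((-1) ^ (p / 2) * p : ℚ) = W) →
        X3BranchMainConjectureAt V p) :
    MissingLowerBoundAt W p :=
  ClassX3Gord.missingLowerBoundAt_rankZero_of_chiBranchLower_of_exact hPal hGZK hmod hmodD hX he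
    hp4 hr (X3Branch.chiBranchLowerLeadingTermAt_of_forall_mainConjecture W p hX.classX3.1 hMC) hEx

/-- **X3♯(G-ord) ∩ `I₀*` ∧ `r_an = 0`, `p ≡ 3 (mod 4)` (`p = 3` included): the branch main conjecture
of every twist model ∧ `ExactLeadingTermAt W p` ⟹ `Typed.MissingLowerBoundAt W p`.**
[cite: Pal2012, Thm. 3.2] [cite: Delbourgo1998, Prop. 4 (p. 144) (shape of the exact input)] -/
theorem ClassX3Gord.missingLowerBoundAt_rankZero_of_x3BranchMainConjecture_odd_of_exact
    (hGZK : rank_eq_analyticRank_of_analyticRank_le_one) (hmod : hasEntireLFunction_rat)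
    (hmodD : nonempty_modularParametrizationData)
    (hX : ClassX3Gord W p) (he : semistabilityIndex W p = 2) (hp4 : p % 4 = 3)
    (hr : W.analyticRank = 0) (hEx : ExactLeadingTermAt W p)
    (hMC : ∀ (V : WeierstrassCurve ℚ) [V.IsElliptic] [V.IsGloballyMinimal],
      (∃ C : VariableChange ℚ, C • V.quadraticTwist ((-1) ^ (p / 2) * p : ℚ) = W) →
        X3BranchMainConjectureAt V p) :
    MissingLowerBoundAt W p :=
  ClassX3Gord.missingLowerBoundAt_rankZero_of_chiBranchLowerOdd_of_exact hGZK hmod hmodD hX he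
    hp4 hr (X3Branch.chiBranchLowerLeadingTermOddAt_of_forall_mainConjecture W p hX.classX3.1 hMC)
    hEx

/-- **THE ROW'S CONSUMER on X3♯(G-ord) ∩ `I₀*` ∧ `r_an = 0`, `p ≡ 1 (mod 4)`**: `hW16` ∧ GV on the
branch ∧ the `μ`-certificate (every twist model) ∧ `ExactLeadingTermAt W p` ⟹
`Typed.MissingLowerBoundAt W p`. [cite: GreenbergVatsal2000, Thm. (1.3) and p. 4]
[cite: Wuthrich2014, Thm. 16 (p. 397)] [cite: Pal2012, Thm. 3.2] [cite: Delbourgo1998, Prop. 4] -/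
theorem ClassX3Gord.missingLowerBoundAt_rankZero_of_x3BranchLambdaEq_of_muZero_of_exact
    (hW16 : Wuthrich2014.thm16_halfEigenCharIdeal_dvd_cyclotomicPrime)
    (hPal : Pal2012.thm32_sqrt_mul_realPeriodRat_twist_eq_of_prime_one_mod_four)
    (hGZK : rank_eq_analyticRank_of_analyticRank_le_one) (hmod : hasEntireLFunction_rat)
    (hmodD : nonempty_modularParametrizationData)
    (hX : ClassX3Gord W p) (he : semistabilityIndex W p = 2) (hp4 : p % 4 = 1)
    (hr : W.analyticRank = 0) (hEx : ExactLeadingTermAt W p)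
    (hlam : ∀ (V : WeierstrassCurve ℚ) [V.IsElliptic] [V.IsGloballyMinimal],
      (∃ C : VariableChange ℚ, C • V.quadraticTwist ((-1) ^ (p / 2) * p : ℚ) = W) →
        X3BranchLambdaEqAt V p)
    (hμ : ∀ (V : WeierstrassCurve ℚ) [V.IsElliptic] [V.IsGloballyMinimal],
      (∃ C : VariableChange ℚ, C • V.quadraticTwist ((-1) ^ (p / 2) * p : ℚ) = W) →
        X3BranchAnalyticMuZeroAt V p) :
    MissingLowerBoundAt W p :=
  ClassX3Gord.missingLowerBoundAt_rankZero_of_x3BranchMainConjecture_of_exact hPal hGZK hmod hmodD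
    hX he hp4 hr hEx (X3Branch.forall_mainConjecture_of_forall_lambdaEq_of_muZero W p hW16 hlam hμ)

/-- **THE ROW'S CONSUMER on X3♯(G-ord) ∩ `I₀*` ∧ `r_an = 0`, `p ≡ 3 (mod 4)` (`p = 3` included)**:
`hW16` ∧ GV on the branch ∧ the `μ`-certificate ∧ `ExactLeadingTermAt W p` ⟹
`Typed.MissingLowerBoundAt W p`. [cite: GreenbergVatsal2000, Thm. (1.3) and p. 4]
[cite: Wuthrich2014, Thm. 16 (p. 397)] [cite: Delbourgo1998, Prop. 4 (p. 144) (shape of the exact input)] -/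
theorem ClassX3Gord.missingLowerBoundAt_rankZero_of_x3BranchLambdaEq_of_muZero_odd_of_exact
    (hW16 : Wuthrich2014.thm16_halfEigenCharIdeal_dvd_cyclotomicPrime)
    (hGZK : rank_eq_analyticRank_of_analyticRank_le_one) (hmod : hasEntireLFunction_rat)
    (hmodD : nonempty_modularParametrizationData)
    (hX : ClassX3Gord W p) (he : semistabilityIndex W p = 2) (hp4 : p % 4 = 3)
    (hr : W.analyticRank = 0) (hEx : ExactLeadingTermAt W p)
    (hlam : ∀ (V : WeierstrassCurve ℚ) [V.IsElliptic] [V.IsGloballyMinimal],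
      (∃ C : VariableChange ℚ, C • V.quadraticTwist ((-1) ^ (p / 2) * p : ℚ) = W) →
        X3BranchLambdaEqAt V p)
    (hμ : ∀ (V : WeierstrassCurve ℚ) [V.IsElliptic] [V.IsGloballyMinimal],
      (∃ C : VariableChange ℚ, C • V.quadraticTwist ((-1) ^ (p / 2) * p : ℚ) = W) →
        X3BranchAnalyticMuZeroAt V p) :
    MissingLowerBoundAt W p :=
  ClassX3Gord.missingLowerBoundAt_rankZero_of_x3BranchMainConjecture_odd_of_exact hGZK hmod hmodD
    hX he hp4 hr hEx (X3Branch.forall_mainConjecture_of_forall_lambdaEq_of_muZero W p hW16 hlam hμ)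

end EndToEnd

end Summit.BirchSwinnertonDyer.Rank1Residual.Additive

end
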